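import Literature.NumberTheory.EllipticCurves.TateSeriesFormalCoeffTwo
import HarnessLib

/-!
# Route `ByReductionTypeAtTwo`, crux `MultUpperHalfAtTwo` (item stmt-BirchSwinnertonDyer-19922), TOWER road, the
# «ONE BIT AT A NON-SPLIT 2» rows: KERNEL BRICK 5 — the Tate UNIT modulo `8`:
# `q · j(q) ≡ 1 (mod 8)` and `q/2^k ≡ (Δ/2^k)·c₄ (mod 8)` when `j(q) = c₄³/Δ`, in any complete ultrametric field

HONEST FRAMING (cell `bsd-2adic`, run/shared/lean/pub/bsd-2adic/, seat `bsd-2adic-tower-1` GEN 8, HUMAN RULINGS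
D-0036 / D-0054 / D-0074): TOOL theorems only (no definition, no named fact, no `sorry`); closes nothing by itself;
nothing booked; BSD is not proved by any of this. Module M3 (step S7) of the KERNELISATION of the displayed MEMO
binder `MultTowerNS2.localTowerKerTwoTorsion_le_two_nonsplitTwo_of_tateUnit` (scope HOME/tower/SCOPE-hNS2one-kernel-GEN8.md;
memo PROOF-NS2ONE §6 «reading u_q off the minimal model»), stated for ANY complete ultrametric normed field `K` with
`|2| < 1` (so that it applies verbatim to the tree's `v.adicCompletion ℚ`, `v ∋ 2`, where the twisted Tate
uniformisation `TateCurve.exists_twistedTateUniformisation_tateJ` delivers `q` with `tateJ q = j(E) = c₄³/Δ_min`, as well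
as to `ℚ_[2]`):

* `norm_mul_tateJ_sub_one_le_of_norm_le` — for `0 < |q| ≤ |2|`: `|q·j(q) − 1| ≤ |2|³`, from the integer expansion
  `q·j(q) = 1 + 744q + 196884q² + ⋯` (`hasSum_coeff_formalXJ`; `8 ∣ 744`, `2 ∣ 196884`, tree
  `coeff_one_formalXJ`, `coeff_two_formalXJ`) and the ultrametric inequality;
* `norm_tateUnit_sub_le` — **if `tateJ q = c³/(2^k u)` with `u, c` odd integers, `k ≥ 1`, `0 < |q| < 1`, then
  `|q/2^k − u·c| ≤ |2|³`**, i.e. the Tate unit `u_q = q/2^{ord q}` satisfies `u_q ≡ u_Δ·c₄ (mod 8)` for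
  `Δ_min = 2^k u_Δ`, `c₄ = c` (`c⁴ ≡ 1 (mod 16)`); this is the congruence that turns the hypothesis
  «`u_Δ·c₄ ≡ ±3 (mod 8)`» of the binder into «`u_q ≡ ±3 (mod 8)`» consumed by BRICK 2 (`…MultTowerNS2Dyadic`).

References: J. H. Silverman, *ATAEC* V.3.1 (b), V.5.3 (a); Nesterenko–Philippon LNM 1752 Ch. 2 Prop. 2.1 (3);
cell memo PROOF-NS2ONE.md §6; scope memo SCOPE-hNS2one-kernel-GEN8.md S7/M3.
-/

set_option autoImplicit false
-- the Theorems namespace of this sub repeats the summit name by design (D-0017 nested layout: Summit.<S>.<Sub>)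
set_option linter.dupNamespace false

noncomputable section

namespace Summit.BirchSwinnertonDyer.BirchSwinnertonDyer.Theorems.MultTowerNS2

open PowerSeries IsUltrametricDist Literature.NumberTheory.EllipticCurves

variable {K : Type*} [NormedField K] [IsUltrametricDist K] [CompleteSpace K]

omit [CompleteSpace K] in
/-- In an ultrametric normed field, `|m·z| ≤ |2|^n` for an integer `z` divisible by `2^n`... precisely: if `2^n ∣ z`
then `|(z : K)| ≤ |2|^n`. [folklore] -/
theorem norm_intCast_le_norm_two_pow_of_dvd {z : ℤ} {n : ℕ} (h : (2 : ℤ) ^ n ∣ z) :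
    ‖(z : K)‖ ≤ ‖(2 : K)‖ ^ n := by
  obtain ⟨m, rfl⟩ := h
  push_cast
  rw [norm_mul, norm_pow]
  exact mul_le_of_le_one_right (pow_nonneg (norm_nonneg _) _) (norm_intCast_le_one K m)

omit [CompleteSpace K] in
/-- **Termwise bound**: for `|q| ≤ |2|` and every `n`, `|c(n+1) q^{n+1}| ≤ |2|³`, where `c(m) = coeff m formalXJ`
(`c(1) = 744 = 8·93`, `c(2) = 196884 = 2·98442`, `c(m) ∈ ℤ`). [folklore] -/
theorem norm_coeff_formalXJ_mul_pow_succ_le_of_norm_le {q : K} (hq : ‖q‖ ≤ ‖(2 : K)‖) (n : ℕ) :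
    ‖((coeff (n + 1) formalXJ : ℤ) : K) * q ^ (n + 1)‖ ≤ ‖(2 : K)‖ ^ 3 := by
  have hq0 : 0 ≤ ‖q‖ := norm_nonneg q
  have h20 : 0 ≤ ‖(2 : K)‖ := norm_nonneg _
  have h21 : ‖(2 : K)‖ ≤ 1 := by exact_mod_cast norm_natCast_le_one K 2
  rw [norm_mul, norm_pow]
  rcases n with _ | _ | n
  · -- `|744| ≤ |2|³`, `|q| ≤ 1`
    have h8 : ‖((coeff 1 formalXJ : ℤ) : K)‖ ≤ ‖(2 : K)‖ ^ 3 :=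
      norm_intCast_le_norm_two_pow_of_dvd (by rw [coeff_one_formalXJ]; norm_num)
    calc ‖((coeff (0 + 1) formalXJ : ℤ) : K)‖ * ‖q‖ ^ (0 + 1)
        ≤ ‖(2 : K)‖ ^ 3 * 1 :=
          mul_le_mul h8 (by rw [zero_add, pow_one]; exact hq.trans h21) (by positivity) (by positivity)
      _ = ‖(2 : K)‖ ^ 3 := mul_one _
  · -- `|196884| ≤ |2|`, `|q|² ≤ |2|²`
    have h2 : ‖((coeff 2 formalXJ : ℤ) : K)‖ ≤ ‖(2 : K)‖ ^ 1 :=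
      norm_intCast_le_norm_two_pow_of_dvd (by rw [coeff_two_formalXJ]; norm_num)
    calc ‖((coeff (1 + 1) formalXJ : ℤ) : K)‖ * ‖q‖ ^ (1 + 1)
        ≤ ‖(2 : K)‖ ^ 1 * ‖(2 : K)‖ ^ 2 := mul_le_mul h2 (pow_le_pow_left₀ hq0 hq 2) (by positivity) (by positivity)
      _ = ‖(2 : K)‖ ^ 3 := by ring
  · -- `|c| ≤ 1`, `|q|^{n+3} ≤ |2|³`
    have hc : ‖((coeff (n + 2 + 1) formalXJ : ℤ) : K)‖ ≤ 1 := norm_intCast_le_one K _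
    have hqp : ‖q‖ ^ (n + 2 + 1) ≤ ‖(2 : K)‖ ^ 3 := by
      calc ‖q‖ ^ (n + 2 + 1) ≤ ‖q‖ ^ 3 := pow_le_pow_of_le_one hq0 (hq.trans h21) (by omega)
        _ ≤ ‖(2 : K)‖ ^ 3 := pow_le_pow_left₀ hq0 hq 3
    calc ‖((coeff (n + 2 + 1) formalXJ : ℤ) : K)‖ * ‖q‖ ^ (n + 2 + 1)
        ≤ 1 * ‖(2 : K)‖ ^ 3 := mul_le_mul hc hqp (by positivity) (by norm_num)
      _ = ‖(2 : K)‖ ^ 3 := one_mul _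

/-- **`q · j(q) ≡ 1 (mod 8)`**: in a complete ultrametric normed field with `|2| < 1`, for `0 < |q| ≤ |2|`,
`|q · tateJ q − 1| ≤ |2|³`. [folklore] -/
theorem norm_mul_tateJ_sub_one_le_of_norm_le (h2 : ‖(2 : K)‖ < 1) {q : K} (hq0 : q ≠ 0)
    (hq : ‖q‖ ≤ ‖(2 : K)‖) : ‖q * tateJ q - 1‖ ≤ ‖(2 : K)‖ ^ 3 := by
  have hq1 : ‖q‖ < 1 := hq.trans_lt h2
  have hs := hasSum_coeff_formalXJ hq0 hq1
  have hs' := (hasSum_nat_add_iff' 1).mpr hs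
  rw [Finset.sum_range_one, coeff_zero_formalXJ, pow_zero, mul_one, Int.cast_one] at hs'
  rw [← hs'.tsum_eq]
  exact norm_tsum_le_of_forall_le_of_nonneg (by positivity) fun n ↦
    norm_coeff_formalXJ_mul_pow_succ_le_of_norm_le hq n

omit [CompleteSpace K] in
/-- An odd integer has norm `1` in an ultrametric normed field with `|2| < 1`. [folklore] -/
theorem norm_intCast_eq_one_of_odd (h2 : ‖(2 : K)‖ < 1) {z : ℤ} (hz : Odd z) : ‖(z : K)‖ = 1 := by
  obtain ⟨m, rfl⟩ := hz
  push_cast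
  have hlt : ‖(2 : K) * (m : K)‖ < ‖(1 : K)‖ := by
    rw [norm_mul, norm_one]
    calc ‖(2 : K)‖ * ‖(m : K)‖ ≤ ‖(2 : K)‖ * 1 :=
          mul_le_mul_of_nonneg_left (norm_intCast_le_one K m) (norm_nonneg _)
      _ < 1 := by rw [mul_one]; exact h2
  rw [norm_add_eq_max_of_norm_ne_norm hlt.ne, max_eq_right hlt.le, norm_one]

omit [CompleteSpace K] in
/-- `c⁴ ≡ 1 (mod 16)` for odd `c`: `|(c : K)^4 − 1| ≤ |2|^4`. [folklore] -/
theorem norm_pow_four_sub_one_le_of_odd {c : ℤ} (hc : Odd c) : ‖(c : K) ^ 4 - 1‖ ≤ ‖(2 : K)‖ ^ 4 := by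
  have h16 : (2 : ℤ) ^ 4 ∣ c ^ 4 - 1 := by
    obtain ⟨m, rfl⟩ := hc
    have hmm : (2 : ℤ) ∣ m * (m + 1) := by
      rcases Int.even_or_odd m with ⟨r, hr⟩ | ⟨r, hr⟩
      · exact ⟨r * (m + 1), by rw [hr]; ring⟩
      · exact ⟨m * (r + 1), by rw [hr]; ring⟩
    obtain ⟨t, ht⟩ := hmm
    exact ⟨t * (2 * m ^ 2 + 2 * m + 1), by linear_combination (8 * (2 * m ^ 2 + 2 * m + 1)) * ht⟩
  have := norm_intCast_le_norm_two_pow_of_dvd (K := K) h16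
  push_cast at this
  exact this

/-- **The Tate unit modulo `8`** (memo PROOF-NS2ONE §6, scope S7): in a complete ultrametric normed field with
`|2| < 1`, if `0 < |q| < 1` and `tateJ q = c³/(2^k·u)` with `u, c` odd integers and `k ≥ 1` — i.e. `j(E) = c₄³/Δ_min`
with `Δ_min = 2^k u`, `c₄ = c` — then `|q/2^k − u·c| ≤ |2|³`: the unit part of `q` is `≡ u·c (mod 8)`.
Proof: `q·j(q) = S` with `|S − 1| ≤ |2|³` (so `|q| = |2|^k ≤ |2|`), `q/2^k = S·u/c³`, and
`S u/c³ − u c = u (S − c⁴)/c³` with `|S − c⁴| ≤ max(|S − 1|, |1 − c⁴|) ≤ |2|³`, `|u| = |c| = 1`. [folklore] -/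
theorem norm_tateUnit_sub_le (h2 : ‖(2 : K)‖ < 1) {q : K} (hq0 : q ≠ 0) (hq1 : ‖q‖ < 1) {k : ℕ} (hk : 1 ≤ k)
    {u c : ℤ} (hu : Odd u) (hc : Odd c)
    (hj : tateJ q = (c : K) ^ 3 / ((2 : K) ^ k * (u : K))) :
    ‖q / (2 : K) ^ k - (u : K) * (c : K)‖ ≤ ‖(2 : K)‖ ^ 3 := by
  have h2pos : 0 < ‖(2 : K)‖ := norm_pos_iff.mpr (fun h ↦ by
    have := h2; rw [h, norm_zero] at this
    -- `2 = 0` would give `|q| < 1` and `tateJ q = c^3/0 = 0`, but then `‖tateJ q‖ = ‖q‖⁻¹ > 1`; contradiction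
    have hj0 : tateJ q = 0 := by rw [hj, h, zero_pow (by omega), zero_mul, div_zero]
    have := norm_tateJ_eq hq1
    rw [hj0, norm_zero] at this
    exact (inv_pos.mpr (norm_pos_iff.mpr hq0)).ne this)
  have h2ne : (2 : K) ≠ 0 := norm_pos_iff.mp h2pos
  have hune : (u : K) ≠ 0 := norm_pos_iff.mp (by rw [norm_intCast_eq_one_of_odd h2 hu]; exact one_pos)
  have hcn : ‖(c : K)‖ = 1 := norm_intCast_eq_one_of_odd h2 hc
  have hcne : (c : K) ≠ 0 := norm_pos_iff.mp (by rw [hcn]; exact one_pos)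
  have hun : ‖(u : K)‖ = 1 := norm_intCast_eq_one_of_odd h2 hu
  -- `|q| = |2|^k ≤ |2|`
  have hqn : ‖q‖ = ‖(2 : K)‖ ^ k := by
    have h := norm_tateJ_eq hq1
    rw [hj, norm_div, norm_pow, hcn, one_pow, norm_mul, norm_pow, hun, mul_one, one_div] at h
    exact inv_injective h |>.symm
  have hq2 : ‖q‖ ≤ ‖(2 : K)‖ := by
    rw [hqn]
    calc ‖(2 : K)‖ ^ k ≤ ‖(2 : K)‖ ^ 1 := pow_le_pow_of_le_one h2pos.le h2.le hk
      _ = ‖(2 : K)‖ := pow_one _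
  -- `S = q · j(q)`, `|S − 1| ≤ |2|³`
  set S := q * tateJ q with hS
  have hS1 : ‖S - 1‖ ≤ ‖(2 : K)‖ ^ 3 := norm_mul_tateJ_sub_one_le_of_norm_le h2 hq0 hq2
  -- `q / 2^k = S u / c³`
  have hq : q / (2 : K) ^ k = S * (u : K) / (c : K) ^ 3 := by
    rw [hS, hj]
    field_simp
  -- `S u/c³ − u c = u (S − c⁴)/c³`
  have hdiff : q / (2 : K) ^ k - (u : K) * (c : K) = (u : K) * (S - (c : K) ^ 4) / (c : K) ^ 3 := by
    rw [hq]; field_simp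
  rw [hdiff, norm_div, norm_mul, norm_pow, hun, hcn, one_mul, one_pow, div_one]
  -- `|S − c⁴| ≤ max (|S − 1|, |1 − c⁴|)`
  have hsplit : S - (c : K) ^ 4 = (S - 1) + (1 - (c : K) ^ 4) := by ring
  rw [hsplit]
  refine (norm_add_le_max _ _).trans (max_le hS1 ?_)
  rw [← norm_neg, neg_sub]
  calc ‖(c : K) ^ 4 - 1‖ ≤ ‖(2 : K)‖ ^ 4 := norm_pow_four_sub_one_le_of_odd hc
    _ ≤ ‖(2 : K)‖ ^ 3 := pow_le_pow_of_le_one h2pos.le h2.le (by norm_num)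

end Summit.BirchSwinnertonDyer.BirchSwinnertonDyer.Theorems.MultTowerNS2

end
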